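import Mathlib
import Summits.ValiantsHypothesis.ValiantsHypothesis.Theorems.RigidityForcesSymmetryRankRigidMinimalReprLaplaceDefs
import Summits.ValiantsHypothesis.ValiantsHypothesis.Theorems.RigidityForcesSymmetryRankRigidMinimalReprLaplaceContractRect

/-!
# Shared-factor restriction: pinning one slot of a split decomposition keeps ALL letters and SHARES one factor of every term
# (crux `RankRigidMinimalRepr`, stmt-ValiantsHypothesis-18034; frontier rung `LaplaceOptimalFive`, stmt-24813 — infrastructure)

`LaplaceRestrict.restrict` pins slot `i` of a split-rank-one decomposition of `P_{d+1}` to a letter `a` AND relabels the other letters,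
landing in the square format of `LaplaceOptimal d`; averaged over slots this yields exactly half of `LaplaceOptimal (d+1)` and no more
(`weight_ge_half`), because it forgets two things: the `(d+1)`-st letter, and the fact that the `d + 1` restricted decompositions
(one per pinned letter `a`) are NOT independent — by locality, every term keeps one of its two factors UNCHANGED as `a` varies:

* if `i ∉ S_t`, the factor `u_t` does not see slot `i`, so `v' ↦ u_t(i.insertNth a v')` is the SAME function for all `a` (`u_shared`);
* if `i ∈ S_t`, the factor `w_t` does not see slot `i`, so `v' ↦ w_t(i.insertNth a v')` is the same for all `a` (`w_shared`);

while the restricted sums are the RECTANGULAR sub-patterns `[v' : Fin d → Fin (d+1) injective, a ∉ range v']` (`restrict_sum`), and the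
restricted factors are local for the restricted splits (`u_local`, `w_local`).  Packaged: `shared_restriction`.

CONSEQUENCE (the «subspace-arrangement» criterion used by the 24813 numerics/census of val-lit-p8 g12, memo NOTE-p8g12-24813-LO45-refuted §5):
a decomposition with a given profile exists only if the `d + 1` sub-patterns `P^{[d+1]∖a}` ALL lie in ONE arrangement
`Σ_{t : i ∉ S_t} u_t ⊗ (anything) + Σ_{t : i ∈ S_t} (anything) ⊗ w_t` whose fixed factors do not depend on `a` — the information that the
factor-two averaging discards.  This file records the easy, purely formal half (decomposition ⇒ shared restricted system) in the official
data format, for every `d`; no weights, no bounds, no definitions.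

HONEST FRAMING: bookkeeping infrastructure inside one route's frontier rung; `LaplaceOptimal 5` (stmt-24813) is OPEN, the crux and `VP ≠ VNP`
are untouched.
-/

set_option autoImplicit false

-- the mandated summit-side namespace repeats a component by design (single-problem summit)
set_option linter.dupNamespace false

namespace Summit.ValiantsHypothesis.ValiantsHypothesis.Theorems.RigidityForcesSymmetryRankRigidMinimalRepr

namespace LaplaceSharedRestrict

open Finset

variable {d N : ℕ}

/-- Two embedded assignments `i.insertNth a v'`, `i.insertNth a' v'` agree at every slot other than `i`. -/
theorem insertNth_agree_off (i a a' : Fin (d + 1)) (v' : Fin d → Fin (d + 1)) (j : Fin (d + 1)) (hj : j ≠ i) :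
    (i.insertNth a v' : Fin (d + 1) → Fin (d + 1)) j = (i.insertNth a' v' : Fin (d + 1) → Fin (d + 1)) j := by
  rcases Fin.eq_self_or_eq_succAbove i j with rfl | ⟨k, rfl⟩
  · exact absurd rfl hj
  · rw [Fin.insertNth_apply_succAbove, Fin.insertNth_apply_succAbove]

/-- **`u`-factor shared.**  If the term's dependence set misses the pinned slot, its `u`-factor restricted to `v i = a` does not depend on `a`. -/
theorem u_shared (S : Fin N → Finset (Fin (d + 1))) (u : Fin N → (Fin (d + 1) → Fin (d + 1)) → ℂ)
    (hu : ∀ t, ∀ v v' : Fin (d + 1) → Fin (d + 1), (∀ j ∈ S t, v j = v' j) → u t v = u t v')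
    (i : Fin (d + 1)) (t : Fin N) (ht : i ∉ S t) (a a' : Fin (d + 1)) (v' : Fin d → Fin (d + 1)) :
    u t (i.insertNth a v') = u t (i.insertNth a' v') := by
  refine hu t _ _ (fun j hj => insertNth_agree_off i a a' v' j ?_)
  rintro rfl
  exact ht hj

/-- **`w`-factor shared.**  If the term's dependence set contains the pinned slot, its `w`-factor restricted to `v i = a` does not depend on `a`. -/
theorem w_shared (S : Fin N → Finset (Fin (d + 1))) (w : Fin N → (Fin (d + 1) → Fin (d + 1)) → ℂ)
    (hw : ∀ t, ∀ v v' : Fin (d + 1) → Fin (d + 1), (∀ j, j ∉ S t → v j = v' j) → w t v = w t v')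
    (i : Fin (d + 1)) (t : Fin N) (ht : i ∈ S t) (a a' : Fin (d + 1)) (v' : Fin d → Fin (d + 1)) :
    w t (i.insertNth a v') = w t (i.insertNth a' v') := by
  refine hw t _ _ (fun j hj => insertNth_agree_off i a a' v' j ?_)
  rintro rfl
  exact hj ht

/-- **Restricted `u`-locality.**  The restricted `u`-factor depends only on the restricted split `{k : i.succAbove k ∈ S_t}`. -/
theorem u_local (S : Fin N → Finset (Fin (d + 1))) (u : Fin N → (Fin (d + 1) → Fin (d + 1)) → ℂ)
    (hu : ∀ t, ∀ v v' : Fin (d + 1) → Fin (d + 1), (∀ j ∈ S t, v j = v' j) → u t v = u t v')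
    (i a : Fin (d + 1)) (t : Fin N) (v' v'' : Fin d → Fin (d + 1))
    (h : ∀ k : Fin d, i.succAbove k ∈ S t → v' k = v'' k) :
    u t (i.insertNth a v') = u t (i.insertNth a v'') := by
  refine hu t _ _ (fun j hj => ?_)
  rcases Fin.eq_self_or_eq_succAbove i j with rfl | ⟨k, rfl⟩
  · rw [Fin.insertNth_apply_same, Fin.insertNth_apply_same]
  · rw [Fin.insertNth_apply_succAbove, Fin.insertNth_apply_succAbove, h k hj]

/-- **Restricted `w`-locality.**  The restricted `w`-factor depends only on the complement of the restricted split. -/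
theorem w_local (S : Fin N → Finset (Fin (d + 1))) (w : Fin N → (Fin (d + 1) → Fin (d + 1)) → ℂ)
    (hw : ∀ t, ∀ v v' : Fin (d + 1) → Fin (d + 1), (∀ j, j ∉ S t → v j = v' j) → w t v = w t v')
    (i a : Fin (d + 1)) (t : Fin N) (v' v'' : Fin d → Fin (d + 1))
    (h : ∀ k : Fin d, i.succAbove k ∉ S t → v' k = v'' k) :
    w t (i.insertNth a v') = w t (i.insertNth a v'') := by
  refine hw t _ _ (fun j hj => ?_)
  rcases Fin.eq_self_or_eq_succAbove i j with rfl | ⟨k, rfl⟩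
  · rw [Fin.insertNth_apply_same, Fin.insertNth_apply_same]
  · rw [Fin.insertNth_apply_succAbove, Fin.insertNth_apply_succAbove, h k hj]

/-- **The restricted sums are the rectangular sub-patterns.**  Pinning slot `i` to the letter `a` turns the pattern `[v injective]`
into `[v' injective ∧ a ∉ range v']` — the injective pattern on the other `d` slots with the letter `a` removed, all other letters kept. -/
theorem restrict_sum (T : Finset (Fin N)) (u w : Fin N → (Fin (d + 1) → Fin (d + 1)) → ℂ)
    (hsum : ∀ v : Fin (d + 1) → Fin (d + 1), (∑ t ∈ T, u t v * w t v) = if Function.Injective v then 1 else 0)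
    (i a : Fin (d + 1)) (v' : Fin d → Fin (d + 1)) :
    (∑ t ∈ T, u t (i.insertNth a v') * w t (i.insertNth a v')) =
      if Function.Injective v' ∧ a ∉ univ.image v' then 1 else 0 := by
  rw [hsum]
  exact if_congr (LaplaceContractRect.ins_injective_iff i a v') rfl rfl

/-- **Shared-factor restriction (packaged).**  For a split-rank-one decomposition of `P_{d+1}` in the data format of `LaplaceOptimal (d+1)`
and a slot `i`: splitting the terms by whether `i ∈ S_t`, the restrictions to `v i = a` read, for EVERY letter `a` and every `v'`,

  `Σ_{t ∈ T, i ∉ S_t} U_t(v') · w_t(i.insertNth a v') + Σ_{t ∈ T, i ∈ S_t} u_t(i.insertNth a v') · W_t(v') = [v' injective ∧ a ∉ range v']`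

with `U_t := u_t(i.insertNth i v' ·)`-type factors that do NOT depend on `a` (here realised as the restrictions at the fixed letter `i`,
which equal the restrictions at every `a`).  So the `d + 1` rectangular sub-patterns share, term by term, one factor each. -/
theorem shared_restriction (T : Finset (Fin N)) (S : Fin N → Finset (Fin (d + 1)))
    (u w : Fin N → (Fin (d + 1) → Fin (d + 1)) → ℂ)
    (hu : ∀ t, ∀ v v' : Fin (d + 1) → Fin (d + 1), (∀ j ∈ S t, v j = v' j) → u t v = u t v')
    (hw : ∀ t, ∀ v v' : Fin (d + 1) → Fin (d + 1), (∀ j, j ∉ S t → v j = v' j) → w t v = w t v')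
    (hsum : ∀ v : Fin (d + 1) → Fin (d + 1), (∑ t ∈ T, u t v * w t v) = if Function.Injective v then 1 else 0)
    (i a : Fin (d + 1)) (v' : Fin d → Fin (d + 1)) :
    (∑ t ∈ T.filter (fun t => i ∉ S t), u t (i.insertNth i v') * w t (i.insertNth a v')) +
      (∑ t ∈ T.filter (fun t => i ∈ S t), u t (i.insertNth a v') * w t (i.insertNth i v')) =
      if Function.Injective v' ∧ a ∉ univ.image v' then 1 else 0 := by
  rw [← restrict_sum T u w hsum i a v']
  -- rewrite the shared factors back to the letter `a`, then recombine the two filtered sums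
  have h1 : (∑ t ∈ T.filter (fun t => i ∉ S t), u t (i.insertNth i v') * w t (i.insertNth a v')) =
      ∑ t ∈ T.filter (fun t => i ∉ S t), u t (i.insertNth a v') * w t (i.insertNth a v') := by
    refine sum_congr rfl (fun t ht => ?_)
    rw [u_shared S u hu i t (mem_filter.mp ht).2 i a v']
  have h2 : (∑ t ∈ T.filter (fun t => i ∈ S t), u t (i.insertNth a v') * w t (i.insertNth i v')) =
      ∑ t ∈ T.filter (fun t => i ∈ S t), u t (i.insertNth a v') * w t (i.insertNth a v') := by
    refine sum_congr rfl (fun t ht => ?_)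
    rw [w_shared S w hw i t (mem_filter.mp ht).2 i a v']
  rw [h1, h2, ← sum_filter_add_sum_filter_not T (fun t => i ∉ S t)]
  simp only [not_not]

/-! ### Converse: a shared restricted system assembles into a decomposition -/

/-- **Assembly (converse of `shared_restriction`).**  Conversely, suppose that for a slot `i` we are given, for every term `t`,
a restricted split `R t ⊆ Fin d`, a flag `b t` («the pinned slot belongs to the term's dependence set»), an `a`-INDEPENDENT factor `F t`
and an `a`-dependent factor `G t a` on the other `d` slots (all letters kept), local for `R t` resp. its complement (the shared factor on the
`u`-side if `b t = false`, on the `w`-side if `b t = true`), summing for every letter `a` to the rectangular sub-pattern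
`[v' injective ∧ a ∉ range v']`.  Then `u t v := …(v i)… (Fin.removeNth i v)` defines a split-rank-one decomposition of `P_{d+1}` in the
data format of `LaplaceOptimal (d+1)` with dependence sets `S t = (R t).map i.succAbove ∪ (if b t then {i} else ∅)`.  Together with
`shared_restriction` this is the criterion «decomposition with a given profile ⟺ shared restricted system» behind the subspace-arrangement
formulation. -/
theorem assemble (T : Finset (Fin N)) (R : Fin N → Finset (Fin d)) (b : Fin N → Bool)
    (F : Fin N → (Fin d → Fin (d + 1)) → ℂ) (G : Fin N → Fin (d + 1) → (Fin d → Fin (d + 1)) → ℂ)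
    (hF : ∀ t, ∀ v v' : Fin d → Fin (d + 1),
      (∀ k, (if b t then k ∉ R t else k ∈ R t) → v k = v' k) → F t v = F t v')
    (hG : ∀ t a, ∀ v v' : Fin d → Fin (d + 1),
      (∀ k, (if b t then k ∈ R t else k ∉ R t) → v k = v' k) → G t a v = G t a v')
    (hsum : ∀ (a : Fin (d + 1)) (v' : Fin d → Fin (d + 1)),
      (∑ t ∈ T, F t v' * G t a v') = if Function.Injective v' ∧ a ∉ univ.image v' then 1 else 0)
    (i : Fin (d + 1)) :
    ∃ (S : Fin N → Finset (Fin (d + 1))) (u w : Fin N → (Fin (d + 1) → Fin (d + 1)) → ℂ),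
      (∀ t, S t = (R t).map (Fin.succAboveEmb i) ∪ (if b t then {i} else ∅)) ∧
      (∀ t, ∀ v v' : Fin (d + 1) → Fin (d + 1), (∀ j ∈ S t, v j = v' j) → u t v = u t v') ∧
      (∀ t, ∀ v v' : Fin (d + 1) → Fin (d + 1), (∀ j, j ∉ S t → v j = v' j) → w t v = w t v') ∧
      (∀ v : Fin (d + 1) → Fin (d + 1), (∑ t ∈ T, u t v * w t v) = if Function.Injective v then 1 else 0) := by
  classical
  refine ⟨fun t => (R t).map (Fin.succAboveEmb i) ∪ (if b t then {i} else ∅),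
    fun t v => if b t then G t (v i) (Fin.removeNth i v) else F t (Fin.removeNth i v),
    fun t v => if b t then F t (Fin.removeNth i v) else G t (v i) (Fin.removeNth i v),
    fun t => rfl, ?_, ?_, ?_⟩
  · -- `u`-locality
    intro t v v' hvv'
    have hmemR : ∀ k, k ∈ R t → v (i.succAbove k) = v' (i.succAbove k) := fun k hk =>
      hvv' _ (mem_union_left _ (mem_map.mpr ⟨k, hk, rfl⟩))
    cases hb : b t
    · simp only [hb, Bool.false_eq_true, ↓reduceIte]
      exact hF t _ _ (fun k hk => by
        simp only [hb, Bool.false_eq_true, ↓reduceIte] at hk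
        simpa [Fin.removeNth] using hmemR k hk)
    · simp only [hb, ↓reduceIte]
      have hi : v i = v' i := hvv' i (mem_union_right _ (by simp [hb]))
      rw [hi]
      exact hG t _ _ _ (fun k hk => by
        simp only [hb, ↓reduceIte] at hk
        simpa [Fin.removeNth] using hmemR k hk)
  · -- `w`-locality
    intro t v v' hvv'
    have hnotR : ∀ k, k ∉ R t → v (i.succAbove k) = v' (i.succAbove k) := fun k hk =>
      hvv' _ (by
        simp only [mem_union, mem_map, Fin.succAboveEmb_apply, not_or]
        refine ⟨?_, ?_⟩
        · rintro ⟨k', hk', hkk'⟩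
          exact hk (Fin.succAbove_right_injective hkk' ▸ hk')
        · cases b t <;> simp [Fin.succAbove_ne])
    cases hb : b t
    · simp only [hb, Bool.false_eq_true, ↓reduceIte]
      have hi : v i = v' i := hvv' i (by
        simp only [mem_union, mem_map, Fin.succAboveEmb_apply, not_or, hb]
        exact ⟨by rintro ⟨k, -, hk⟩; exact Fin.succAbove_ne i k hk, by simp⟩)
      rw [hi]
      exact hG t _ _ _ (fun k hk => by
        simp only [hb, Bool.false_eq_true, ↓reduceIte] at hk
        simpa [Fin.removeNth] using hnotR k hk)
    · simp only [hb, ↓reduceIte]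
      exact hF t _ _ (fun k hk => by
        simp only [hb, ↓reduceIte] at hk
        simpa [Fin.removeNth] using hnotR k hk)
  · -- the identity: restrict at `a = v i`, `v' = removeNth i v`
    intro v
    have key := hsum (v i) (Fin.removeNth i v)
    have hprod : ∀ t ∈ T, (if b t then G t (v i) (Fin.removeNth i v) else F t (Fin.removeNth i v)) *
        (if b t then F t (Fin.removeNth i v) else G t (v i) (Fin.removeNth i v)) =
        F t (Fin.removeNth i v) * G t (v i) (Fin.removeNth i v) := by
      intro t _
      cases b t <;> simp [mul_comm]
    rw [sum_congr rfl hprod, key]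
    refine if_congr ?_ rfl rfl
    rw [← LaplaceContractRect.ins_injective_iff i (v i) (Fin.removeNth i v), Fin.insertNth_self_removeNth]

end LaplaceSharedRestrict

end Summit.ValiantsHypothesis.ValiantsHypothesis.Theorems.RigidityForcesSymmetryRankRigidMinimalRepr
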